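import Summits.BirchSwinnertonDyer.Rank1Residual.X2.SplitHalvesOnTreeInt
import Summits.BirchSwinnertonDyer.Rank1Residual.X2.NonsplitCellCClass
import HarnessLib

/-!
# O9 ∩ {SPLIT} AT THE CLASS LEVEL over the WIDE receptacle: `X2c ∩ {split} ⇒ BSD(E,p)` from c2s♭ ∧
# c3s♭ ∧ CTL-split + Mazur's MC on X2b ∩ {split} + PUBLISHED facts — the residual c1s is GONE (cell
# `bsd-eis`, seat `bsd-eis-cgshw` g8; route `EisensteinPrimes`, crux 4 `BSDpOnCellC` =
# stmt-BirchSwinnertonDyer-19034, line b1 reshape v3 → v4; ♭ twin of cgshw g6's `X2/SplitCellCClass.lean`,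
# split twin of k5-c4's `X2/NonsplitCellCClassInt.lean` p427906; THEOREMS ONLY)

HONEST FRAMING (cell `bsd-eis`, run/shared/lean/pub/bsd-eis/): theorems only; nothing booked; X2 stays
CONSTRUCTION-SHAPED; no label or count moves. g6's `X2/SplitCellCClass.lean` assembled the split road of
crux 4 from FOUR residuals (c1s `SplitHsiehFrameResidualAt`, c2s, c3s, CTL-split) over `R₀`-frames; with
the split halves re-typed over `𝓞_{ℂ_p}`-frames (`X2/SplitHalvesOnTreeInt.lean`, this seat) the frame is
produced by Hsieh 2014 Thm. 1 ALONE (k5-c4's sign-free `exists_isBDPLFunctionInt_of_hsieh2014_of_classX2`),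
so the same two theorems hold with c1s REMOVED:

* `bsdp_of_cellC_of_split_of_manin_of_intResiduals` — a rank-one X2 pair at a SPLIT `p` carrying a
  Manin datum prime to `p`: PUB (incl. Hsieh 2014 Thm. 1, Hoffstein–Luo, GZ, Kolyvagin, Heegner
  rationality) + c2s♭ + c3s♭ + CTL-split at the pair + Mazur's MC on X2b ∩ {split} ⟹ `BSD(E,p)` —
  every datum of the road PRODUCED exactly as in g6's file (admissible `K`, Heegner datum and point,
  Néron model of the twist, transport values, anticyclotomic `κ`, `γ`, degree-one `𝔭`);
* `bsdp_of_cellC_of_split_of_intResiduals` — CLASS LEVEL (Manin moved to the optimal curve, Cassels):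
  `∀ W p, CellC W p → split → BSDp W p` from PUB + (∀ split CellC: c2s♭) + (∀ split CellC: c3s♭) +
  (∀ split CellC: CTL-split) + (∀ split CellB: MazurMainConjectureAt) — the split branch of line b1's
  composition WITHOUT `stub_c1_split`.

References: [CastellaEtAl2021] Thm. 5.3.1; [Hsieh2014] Thm. 1; [Mazur1978] Cor. 4.1; [KellerYin2024]
Thm. 5.1.3 (PRE); cgshw MEMO-7 / MEMO-10, k5-c4 MEMO-1.
-/

set_option autoImplicit false

noncomputable section

open scoped Classical MatrixGroups ModularForm

open CongruenceSubgroup WeierstrassCurve NumberField IsDedekindDomain Field PowerSeries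
  Literature.NumberTheory.EllipticCurves Literature.NumberTheory.EllipticCurves.GreenbergSelmer
  Literature.NumberTheory.EllipticCurves.ModularForms Literature.NumberTheory.QuadraticFields
  Literature.NumberTheory.EllipticCurves.Rank1Residual
  Literature.NumberTheory.EllipticCurves.Rank1Residual.Typed
  Literature.NumberTheory.EllipticCurves.KrizLi2019
  Literature.NumberTheory.EllipticCurves.GreenbergVatsal2000
  Literature.NumberTheory.EllipticCurves.Wuthrich2014
  Literature.NumberTheory.EllipticCurves.SteinWuthrich2013
  Literature.NumberTheory.GaloisRepresentations Literature.NumberTheory.GaloisCohomology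
  Literature.NumberTheory.Automorphic
  Summit.BirchSwinnertonDyer.Rank1Residual.X11b.AcSelmer
  Summit.BirchSwinnertonDyer.Rank1Residual.X11b.Halves
  Summit.BirchSwinnertonDyer.Rank1Residual.X11b

namespace Summit.BirchSwinnertonDyer.Rank1Residual.X2

/-! ### Pointwise: a split CellC pair carrying a Manin datum prime to `p`, NO c1s -/

section Pointwise

variable (W : WeierstrassCurve ℚ) [W.IsElliptic] [W.IsGloballyMinimal] (p : ℕ) [Fact p.Prime]

/-- **X2c ∩ {SPLIT} ⇒ `BSD(E,p)` at a pair carrying a Manin datum prime to `p`, from c2s♭ ∧ c3s♭ ∧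
CTL-split at the pair, Mazur's MC on X2b ∩ {split}, and PUBLISHED facts — NO c1s** (g6's
`bsdp_of_cellC_of_split_of_manin_of_residuals` with `hres` REMOVED and the halves read over the wide
receptacle; the data are produced verbatim as there). CONDITIONAL on every listed binder; nothing booked.
[cite: CastellaEtAl2021, Thm. 5.3.1 and (5.5)–(5.7)] [cite: Hsieh2014, Thm. 1 (arXiv:1112.1580 pp. 3–4)]
[claim: KellerYin2024, status: under-review] [cite: Miller2011LMS, Def. 1.1] -/
theorem bsdp_of_cellC_of_split_of_manin_of_intResiduals
    (hGV : lambdaMu_multiplicative_of_gvPar) (hWu : thm16_charIdeal_dvd_multiplicative_of_reducible)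
    (hJs : thm61_splitMultiplicative) (hJn : thm61_nonsplitMultiplicative)
    (hHs : exists_isSplitMultCanonical) (hHn : exists_isMultCanonical)
    (hpar : nonempty_modularParametrizationData)
    (hGS : ∀ (W : WeierstrassCurve ℚ) [W.IsElliptic] [W.IsGloballyMinimal] (p : ℕ) [Fact p.Prime],
      greenberg_stevens (W := W) (p := p))
    (hnf : exists_isNewformOf) (hH : hsieh2014_exists_anticyclotomicPAdicLFunction)
    (hGZ : ∀ (N : ℕ) [NeZero N] (W : WeierstrassCurve ℚ) (K : Type) [Field K] [NumberField K],
      gross_zagier N W K)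
    (hKo : ∀ (N : ℕ) [NeZero N] (W : WeierstrassCurve ℚ) (K : Type) [Field K] [NumberField K],
      kolyvagin N W K)
    (hHP : ∀ (N : ℕ) [NeZero N] (W : WeierstrassCurve ℚ) (K : Type) [Field K] [NumberField K],
      heegnerPointComplex_mem_range_map N W K)
    (hGZK : rank_eq_analyticRank_of_analyticRank_le_one)
    (hHL : HoffsteinLuo1997_exists_twist_L_one_ne_zero)
    (hc : CellC W p) (hs : W.HasSplitMultiplicativeReductionAtPrime p)
    (hMan : HasPrimeToManinDatum W p)
    (h2 : SplitBDPValueOnTreeInt W p) (h3 : SplitIMCEqOnTreeInt W p)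
    (hCTL : SplitControlOnTree W p)
    (hMCB : ∀ (W' : WeierstrassCurve ℚ) [W'.IsElliptic] [W'.IsGloballyMinimal],
      CellB W' p → W'.HasSplitMultiplicativeReductionAtPrime p → MazurMainConjectureAt W' p) :
    BSDp W p := by
  have hp : p.Prime := Fact.out
  have hmod : hasEntireLFunction_rat := WeierstrassCurve.hasEntireLFunction_rat_of_exists_isNewformOf hnf
  obtain ⟨hr, hp2, hred, hmult⟩ := hc
  haveI : NeZero (W.conductorNorm ℤ) := ⟨(W.conductorNorm_pos_holds).ne'⟩
  -- `w(E) = -1`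
  have hw : W.rootNumber = -1 := by
    rw [WeierstrassCurve.rootNumber_eq_neg_one_pow_analyticRank_of_exists_isNewformOf hnf W, hr]
    norm_num
  -- the admissible auxiliary field
  obtain ⟨K, _, _, hK, hodd, hlt, hHN, hHp, hLK⟩ :=
    exists_admissibleField_of_rootNumber_eq_neg_one hnf hHL W hw p
  -- the datum with `p ∤ c`, a Heegner datum and the `K`-rational Heegner point
  obtain ⟨Dt, hcM⟩ := hMan
  obtain ⟨β, hβ⟩ := exists_dvd_sq_sub_discr_holds (W.conductorNorm ℤ) K hK hHN
  obtain ⟨H, -⟩ := nonempty_heegnerDatum_holds (W.conductorNorm ℤ) K hK hβ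
  obtain ⟨ι⟩ : Nonempty (K →+* ℂ) := inferInstance
  obtain ⟨P, hP⟩ := hHP (W.conductorNorm ℤ) W K hK hHN Dt H ι
  -- the Heegner point has infinite order: `L'(E/K,1) = L'(E,1)·L(E^K,1) ≠ 0` (Gross–Zagier)
  have hL0 : W.entireLFunction 1 = 0 := entireLFunction_one_eq_zero_of_analyticRank_eq_one hr
  obtain ⟨-, hderiv⟩ := leadingLCoeff_eq_deriv_of_analyticRank_eq_one hr
  have hLKd : LDerivEK W K ≠ 0 := by
    rw [lDerivEK_eq_deriv_mul W K hmod hL0]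
    exact mul_ne_zero hderiv hLK
  have hPH : IsHeegnerPoint (W.conductorNorm ℤ) W K P := ⟨Dt, H, ι, hP⟩
  have hPinf : ¬ IsOfFinAddOrder P :=
    (lDerivEK_ne_zero_iff_not_isOfFinAddOrder W (W.conductorNorm ℤ) K (hGZ _ W K) hK hHN hPH).mp hLKd
  -- a globally minimal model of the twist (Néron) and its transport values
  have hD0 : (NumberField.discr K : ℚ) ≠ 0 := by exact_mod_cast NumberField.discr_ne_zero K
  haveI hEt : (W.quadraticTwist (NumberField.discr K : ℚ)).IsElliptic :=
    W.isElliptic_quadraticTwist hD0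
  obtain ⟨Cd, hCd⟩ := hasGlobalMinimalModel_rat_holds (W.quadraticTwist (NumberField.discr K : ℚ))
  set Wd : WeierstrassCurve ℚ := Cd • W.quadraticTwist (NumberField.discr K : ℚ) with hWd_def
  haveI : Wd.IsGloballyMinimal := hCd
  have hWd : Cd • W.quadraticTwist (NumberField.discr K : ℚ) = Wd := rfl
  have hC : Cd⁻¹ • Wd = W.quadraticTwist (NumberField.discr K : ℚ) := by
    rw [← hWd, inv_smul_smul]
  obtain ⟨htam, hu⟩ := twistTransportPackage_holds W p K Wd Cd ⟨hr, hp2, hred, hmult⟩ hK hodd hHN hWd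
  have htamK : padicValNat p (W.baseChange K).tamagawaProduct = 2 * padicValNat p W.tamagawaProduct :=
    padicValNat_tamagawaProduct_baseChange_of_heegner_odd W p hp2 K hK hodd hHN hHp
  -- the twist: analytic rank `0`, X2, SPLIT at `p`; its rank-zero `p`-part by parity cases
  have hLd : Wd.entireLFunction 1 ≠ 0 := by
    rw [← hWd, entireLFunction_smul]; exact hLK
  have hrd : Wd.analyticRank = 0 := (Wd.analyticRank_eq_zero_iff_holds (hmod _)).2 hLd
  have hXd : ClassX2 Wd p := classX2_twist W p ⟨hp2, hred, hmult⟩ K hK hHp Wd ⟨Cd⁻¹, hC⟩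
  have hsd : Wd.HasSplitMultiplicativeReductionAtPrime p :=
    (hasSplitMultiplicativeReductionAtPrime_iff_of_smul_eq_quadraticTwist W Wd hK p hp2 hmult hHp
      hC).mpr hs
  have hbsdd : BSDp Wd p := by
    by_cases hgv : GVPar Wd p
    · exact targetA_of_published hGV hWu hJs hJn hHs hHn hGZK hmod hpar hGS Wd p ⟨hrd, hXd, hgv⟩
    · exact bsdp_of_mazurMainConjectureAt_of_analyticRank_eq_zero hJs hJn hHs hHn hGZK hmod hpar Wd p
        (hGS Wd p) hXd.1 hXd.2.2 hrd (hMCB Wd ⟨hrd, hXd, hgv⟩ hsd)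
  have htw : PPartRankZero Wd p :=
    pPartRankZero_of_pPart hGZK Wd p hrd (pPart_of_bsdp hmod hGZK Wd p (by omega) hbsdd)
  -- the anticyclotomic `ℤ_p`-extension, a topological generator, a degree-one prime above `p`
  haveI : IsTotallyComplex K := hK.2
  obtain ⟨κ, hκ⟩ := ZpExtension.exists_isAnticyclotomic_holds (K := K) (p := p) hK.1
    (fun w ↦ IsTotallyComplex.isComplex w)
  obtain ⟨γ, hγ⟩ := κ.surjective (Multiplicative.ofAdd 1)
  haveI : Fact (κ.IsTopGenerator γ) := ⟨hγ⟩
  obtain ⟨𝔭, h𝔭, he, hf⟩ := X11b.exists_degreeOnePrime_of_splitsIn K p hK.1 (hHp p hp dvd_rfl)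
  -- conclude by the split road
  exact bsdp_of_cellC_of_split_of_hsieh2014_of_intHalvesOnTree_of_partner W p hnf hH
    (W.conductorNorm ℤ) K Dt H ι P (hGZ _ W K) (hKo _ W K) hGZK ⟨hr, hp2, hred, hmult⟩ hs rfl hK hlt hHN
    hHp hP hPinf hcM hLK Wd Cd hWd htw htam hu htamK κ hκ γ 𝔭 h𝔭 he hf h2 h3 hCTL


end Pointwise

/-! ### Class level: the Manin condition moved to the optimal curve -/

section ClassLevel

/-- **X2c ∩ {SPLIT} ⇒ `BSD(E,p)`, CLASS LEVEL, over the wide receptacle — the split branch of line b1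
from c2s♭ ∧ c3s♭ ∧ CTL-split + Mazur's MC on X2b ∩ {split} + PUBLISHED facts, NO c1s and NO per-pair
binder** (g6's `bsdp_of_cellC_of_split_of_residuals` with `hres` removed: the optimal curve `W₀ ∼ W`
carries a Manin datum prime to `p`; CellC and the split type pass to `W₀`; Cassels).
CONDITIONAL on every listed binder; nothing booked; X2 CONSTRUCTION-SHAPED; no label change.
[cite: CastellaEtAl2021, Thm. 5.3.1] [cite: Mazur1978, Cor. 4.1] [cite: Hsieh2014, Thm. 1 (arXiv:1112.1580 pp. 3–4)]
[claim: KellerYin2024, status: under-review] [cite: Miller2011LMS, Def. 1.1] -/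
theorem bsdp_of_cellC_of_split_of_intResiduals
    (hGV : lambdaMu_multiplicative_of_gvPar) (hWu : thm16_charIdeal_dvd_multiplicative_of_reducible)
    (hJs : thm61_splitMultiplicative) (hJn : thm61_nonsplitMultiplicative)
    (hHs : exists_isSplitMultCanonical) (hHn : exists_isMultCanonical)
    (hpar : nonempty_modularParametrizationData)
    (hGS : ∀ (W : WeierstrassCurve ℚ) [W.IsElliptic] [W.IsGloballyMinimal] (p : ℕ) [Fact p.Prime],
      greenberg_stevens (W := W) (p := p))
    (hnf : exists_isNewformOf) (hH : hsieh2014_exists_anticyclotomicPAdicLFunction)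
    (hGZ : ∀ (N : ℕ) [NeZero N] (W : WeierstrassCurve ℚ) (K : Type) [Field K] [NumberField K],
      gross_zagier N W K)
    (hKo : ∀ (N : ℕ) [NeZero N] (W : WeierstrassCurve ℚ) (K : Type) [Field K] [NumberField K],
      kolyvagin N W K)
    (hHP : ∀ (N : ℕ) [NeZero N] (W : WeierstrassCurve ℚ) (K : Type) [Field K] [NumberField K],
      heegnerPointComplex_mem_range_map N W K)
    (hGZK : rank_eq_analyticRank_of_analyticRank_le_one)
    (hHL : HoffsteinLuo1997_exists_twist_L_one_ne_zero)
    (hEd : edixhoven_optimalManinConstant_integral) (hMaz : mazur_not_dvd_maninConstant_of_odd)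
    (hCassels : bsdRHS_eq_of_isIsogenous)
    (h2 : ∀ (W : WeierstrassCurve ℚ) [W.IsElliptic] [W.IsGloballyMinimal] (p : ℕ) [Fact p.Prime],
      CellC W p → W.HasSplitMultiplicativeReductionAtPrime p → SplitBDPValueOnTreeInt W p)
    (h3 : ∀ (W : WeierstrassCurve ℚ) [W.IsElliptic] [W.IsGloballyMinimal] (p : ℕ) [Fact p.Prime],
      CellC W p → W.HasSplitMultiplicativeReductionAtPrime p → SplitIMCEqOnTreeInt W p)
    (hCTL : ∀ (W : WeierstrassCurve ℚ) [W.IsElliptic] [W.IsGloballyMinimal] (p : ℕ) [Fact p.Prime],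
      CellC W p → W.HasSplitMultiplicativeReductionAtPrime p → SplitControlOnTree W p)
    (hMCB : ∀ (W : WeierstrassCurve ℚ) [W.IsElliptic] [W.IsGloballyMinimal] (p : ℕ) [Fact p.Prime],
      CellB W p → W.HasSplitMultiplicativeReductionAtPrime p → MazurMainConjectureAt W p)
    (W : WeierstrassCurve ℚ) [W.IsElliptic] [W.IsGloballyMinimal] (p : ℕ) [Fact p.Prime]
    (hc : CellC W p) (hs : W.HasSplitMultiplicativeReductionAtPrime p) : BSDp W p := by
  refine bsdp_of_cellC_of_forall_isIsogenous hEd hMaz hCassels hpar hnf hGZK W p hc ?_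
  intro W₀ _ _ hiso hc₀ hMan₀
  have hs₀ : W₀.HasSplitMultiplicativeReductionAtPrime p :=
    IsogenyQuotientLine.hasSplitMultiplicativeReductionAtPrime_of_isIsogenous hiso hs
  exact bsdp_of_cellC_of_split_of_manin_of_intResiduals W₀ p hGV hWu hJs hJn hHs hHn hpar hGS hnf hH
    hGZ hKo hHP hGZK hHL hc₀ hs₀ hMan₀ (h2 W₀ p hc₀ hs₀) (h3 W₀ p hc₀ hs₀) (hCTL W₀ p hc₀ hs₀)
    (fun W' _ _ hB hs' ↦ hMCB W' p hB hs')

end ClassLevel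

end Summit.BirchSwinnertonDyer.Rank1Residual.X2

end
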